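import Summits.QuantumFields.YangMills.Theorems.AllWindowsColdBoxBoxHighWindowsSU22LineDefs
import Literature.MathematicalPhysics.QuantumFieldTheory.SU2HiggsKeyEstimate

/-!
# LINE-20 stub U3 `LandauBallUniqueness`, part 1: the quaternion coordinates of the Landau-gauge data

Toward the registered stub U3 `stub_landauBallUniqueness : LandauBallUniqueness` of LINE-20 «landau-rung3» (crux
`AllWindowsColdBox.BoxWindowHighSU2213`, ⟨stmt-QuantumFields-24336⟩; parent ⟨24004⟩).  The proof of U3 runs in the quaternion model
`su2Quat : SU(2) → ℍ` of `Literature…SU2Haar` (first-row convention `q = Re U₀₀ + Im U₀₀·i + Re U₀₁·j + Im U₀₁·k`; multiplicativity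
`su2Quat_mul` and `su2Deficit_eq_norm_sub_sq` are the tree's, `Literature…SU2HiggsKeyEstimate`).  This file supplies the three readings the
lattice argument needs:

* `su2Quat_mul_mul_inv` — `q(g U g'⁻¹) = q(g) q(U) q(g')⋆`, and `eq_one_of_im_su2Quat_eq_zero` — `Im q(U) = 0 ∧ 0 < Re q(U) ⇒ U = 1`;
* `linkDefect_eq_norm_sq` — the line's link defect `2 − Re tr U_e` IS `‖q(U_e) − 1‖²`, so `‖q(U_e) − 1‖ ≤ r` on a link of defect `≤ r²`;
* `im_su2Quat_eq_of_sub_conjTranspose` and `sum_im_su2Quat_eq_of_inLandauGauge` — the lattice Landau condition `InLandauGauge` (a matrix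
  identity in `U − Uᴴ`) read in coordinates: `Σ_μ Im q(U_{x,μ}) = Σ_μ Im q(U_{x−e_μ,μ})` at every interior site (`d* Im q(U) = 0`).

Everything proved, Mathlib + tree only, no definitions; standard axioms.  HONEST LABEL: helper toward ONE registered stub (U3) of a critic-stamped
DRAFT line on the R2ξ″ crux; no stub is proved by name here, no crux, rung or summit is proved; the Yang–Mills mass gap is NOT proved by this file.
-/

set_option autoImplicit false

noncomputable section

open Matrix Quaternion
open Literature.MathematicalPhysics.QuantumLattice (su2Quat quatMatrix quatMatrix_su2Quat quatMatrix_one norm_su2Quat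
  quatToSU2_su2Quat su2_apply_10 LGConfig)
open Literature.MathematicalPhysics.QuantumFieldTheory (su2Quat_mul quatMatrix_injective su2Deficit_eq_norm_sub_sq)
open Literature.Probability.LatticeModels (Site)

namespace Summit.QuantumFields.YangMills.Theorems.AllWindowsColdBoxBoxHighLine.LandauBall

/-! ## Gauge-transformed links in quaternion coordinates -/

/-- `q(g · U · g'⁻¹) = q(g) · q(U) · q(g')⋆` — the quaternion reading of a gauge-transformed link (`q` multiplicative, `q(1) = 1`,
`q⋆ q = ‖q‖² = 1`). -/
theorem su2Quat_mul_mul_inv (g U g' : SU2) : su2Quat (g * U * g'⁻¹) = su2Quat g * su2Quat U * star (su2Quat g') := by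
  have hone : su2Quat (1 : SU2) = 1 := by
    apply quatMatrix_injective
    rw [quatMatrix_su2Quat, quatMatrix_one]
    rfl
  have h1 : su2Quat g'⁻¹ * su2Quat g' = 1 := by rw [← su2Quat_mul, inv_mul_cancel, hone]
  have h2 : star (su2Quat g') * su2Quat g' = 1 := by
    rw [Quaternion.star_mul_self, normSq_eq_norm_mul_self, norm_su2Quat, mul_one, Quaternion.coe_one]
  have hinv : su2Quat g'⁻¹ = star (su2Quat g') :=
    mul_right_cancel₀ (Literature.MathematicalPhysics.QuantumLattice.su2Quat_ne_zero g') (h1.trans h2.symm)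
  rw [su2Quat_mul, su2Quat_mul, hinv]

/-- A link whose quaternion has vanishing imaginary part and positive real part is the identity. -/
theorem eq_one_of_im_su2Quat_eq_zero {U : SU2} (him : (su2Quat U).im = 0) (hre : 0 < (su2Quat U).re) : U = 1 := by
  set q := su2Quat U with hq
  have hn : normSq q = 1 := by rw [normSq_eq_norm_mul_self, hq, norm_su2Quat, mul_one]
  have hI : q.imI = 0 := by rw [← imI_im, him]; rfl
  have hJ : q.imJ = 0 := by rw [← imJ_im, him]; rfl
  have hK : q.imK = 0 := by rw [← imK_im, him]; rfl
  rw [normSq_def'] at hn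
  change q.re ^ 2 + q.imI ^ 2 + q.imJ ^ 2 + q.imK ^ 2 = 1 at hn
  rw [hI, hJ, hK] at hn
  have hre1 : q.re = 1 := by nlinarith
  have hq1 : q = 1 := by ext; exacts [hre1, hI, hJ, hK]
  have hone : su2Quat (1 : SU2) = 1 := by
    apply quatMatrix_injective
    rw [quatMatrix_su2Quat, quatMatrix_one]
    rfl
  rw [← quatToSU2_su2Quat U, ← hq, hq1, ← hone, quatToSU2_su2Quat]

/-! ## The link defect is the squared quaternion distance to `1` -/

/-- **The line's link defect in quaternion coordinates**: `linkDefect U e = 2 − Re tr U_e = ‖su2Quat (U e) − 1‖²`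
(the tree's `su2Deficit_eq_norm_sub_sq`). -/
theorem linkDefect_eq_norm_sq (U : LGConfig 4 SU2) (e : Literature.MathematicalPhysics.QuantumLattice.ZdEdge 4) :
    linkDefect U e = ‖su2Quat (U e) - 1‖ ^ 2 := by
  rw [norm_sub_rev]
  exact su2Deficit_eq_norm_sub_sq (U e)

/-- `‖su2Quat (U e) − 1‖ ≤ r` on a link of defect `≤ r²` (`0 ≤ r`). -/
theorem norm_su2Quat_sub_one_le {U : LGConfig 4 SU2} {e : Literature.MathematicalPhysics.QuantumLattice.ZdEdge 4} {r : ℝ}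
    (hr : 0 ≤ r) (h : linkDefect U e ≤ r ^ 2) : ‖su2Quat (U e) - 1‖ ≤ r := by
  rw [linkDefect_eq_norm_sq] at h
  exact (abs_le_of_sq_le_sq' h hr).2

/-! ## The lattice Landau condition in quaternion coordinates -/

/-- For `W ∈ SU(2)`: the functional `M ↦ ½(Im M₀₀·i + Re M₀₁·j + Im M₀₁·k)` reads `Im (su2Quat W)` off `W − Wᴴ`
(`W₀₀ − conj W₀₀ = 2i·Im W₀₀`, `W₀₁ − conj W₁₀ = 2 W₀₁`). -/
theorem im_su2Quat_eq_of_sub_conjTranspose (W : SU2) :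
    (su2Quat W).im =
      ⟨0, ((((W : Matrix (Fin 2) (Fin 2) ℂ) - (W : Matrix (Fin 2) (Fin 2) ℂ)ᴴ) 0 0).im) / 2,
        ((((W : Matrix (Fin 2) (Fin 2) ℂ) - (W : Matrix (Fin 2) (Fin 2) ℂ)ᴴ) 0 1).re) / 2,
        ((((W : Matrix (Fin 2) (Fin 2) ℂ) - (W : Matrix (Fin 2) (Fin 2) ℂ)ᴴ) 0 1).im) / 2⟩ := by
  have h10 := su2_apply_10 W
  ext
  · rfl
  · simp [Matrix.conjTranspose_apply, su2Quat]
  · simp [Matrix.conjTranspose_apply, su2Quat, h10]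
  · simp [Matrix.conjTranspose_apply, su2Quat, h10]

/-- **Lattice Landau gauge in coordinates**: at every interior site, `Σ_μ Im q(U_{x,μ}) = Σ_μ Im q(U_{x−e_μ,μ})`
(the lattice divergence of the imaginary-part one-form vanishes). -/
theorem sum_im_su2Quat_eq_of_inLandauGauge {H : ℕ} {U : LGConfig 4 SU2} (hL : InLandauGauge H U) {x : Site 4}
    (hx : x ∈ interiorSites H) :
    ∑ μ : Fin 4, (su2Quat (U (x, μ))).im = ∑ μ : Fin 4, (su2Quat (U (x - Pi.single μ 1, μ))).im := by
  -- the additive functional `M ↦ ½(Im M₀₀·i + Re M₀₁·j + Im M₀₁·k)`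
  let Φ : Matrix (Fin 2) (Fin 2) ℂ →+ ℍ :=
    { toFun := fun M => ⟨0, (M 0 0).im / 2, (M 0 1).re / 2, (M 0 1).im / 2⟩
      map_zero' := by ext <;> simp
      map_add' := fun M N => by ext <;> simp <;> ring }
  have hΦ : ∀ W : SU2, Φ ((W : Matrix (Fin 2) (Fin 2) ℂ) - (W : Matrix (Fin 2) (Fin 2) ℂ)ᴴ) = (su2Quat W).im :=
    fun W => (im_su2Quat_eq_of_sub_conjTranspose W).symm
  have h := congrArg Φ (hL x hx)
  rw [map_sum, map_sum] at h
  simpa only [hΦ] using h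

end Summit.QuantumFields.YangMills.Theorems.AllWindowsColdBoxBoxHighLine.LandauBall

end
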